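import Summits.MatrixMultiplication.MatrixMultiplication.Theorems.FarEdgeDescentSupportClass
import HarnessLib

/-!
# Far-edge descent, Kernel XI-b — the special stratum of the support class: normal form,
# symmetries, transport

Support for `Summit.MatrixMultiplication.MatrixMultiplication.Theses.FarEdgeDescent`
(aside `SubLogRate`; lens «structural dichotomy (special vs generic)», generation 36).

Kernel X-d (`FarEdgeDescentSupportClass`) split the support class
`V_S = {T : supp T ⊆ supp ⟨2,2,2⟩}` (twisted coordinates, `⟨2,2,2⟩ ≅ 𝔖(1)`) into
GENERIC members (full support: torus translates `(α⊗β⊗γ)·𝔖(q)`, `q ≠ 0`) and SPECIAL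
members (some support entry vanishes).  This file supplies the field-independent algebra
that pins the special stratum to the one special member `𝔖(0)` of the line (the cap itself,
which needs an infinite field, is `FarEdgeDescentSpecialValue`):

* (§1) `𝔖(q) = 𝔖(0) + q • E` with `E` the elementary tensor at the DELETED ENTRY
  `p₀ = (inr (1,0), (1,0), inr (0,0))`, and `supp 𝔖(0) = supp 𝔖(1) ∖ {p₀}`;
* (§2) **normal form at `p₀`** (`exists_scale_fam_zero`): a tensor supported in `supp 𝔖(1)`,
  vanishing at `p₀` and non-zero on the rest of `supp 𝔖(0)` is a nowhere-zero torus translate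
  of `𝔖(0)` — BCZ's Lemma 3 applied to `T + E`, then the entry deleted again;
* (§3) three involutions of the index sets — side swap, row flip of the first leaf (with the
  matching flip of the middle index), row flip of the second leaf — FIX `𝔖(1)` (kernel-checked
  invariance of the support condition) and move `p₀` to every one of the eight support entries
  `pt σ i k = (leaf σ i, (i,k), leaf σ k)`;
* (§4) **transport**: universal spectral points are invariant under index relabelling, so a cap
  "`T ∈ V_S`, `T(p) = 0` ⟹ `Φ(T) ≤ s`" at one support entry `p` holds at all eight
  (`capAt_all`).

## References

* M. Bläser, M. Christandl, J. Zuiddam, *The border support rank of two-by-two matrix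
  multiplication is seven*, arXiv:1705.09652 (2017), Lemma 3, Def. 5.
  [BlaserChristandlZuiddam2017]
* V. Strassen, *The asymptotic spectrum of tensors*, J. reine angew. Math. 384 (1988), §2.
  [Strassen1988]
-/

noncomputable section

open scoped BigOperators

set_option linter.dupNamespace false

namespace Summit.MatrixMultiplication.MatrixMultiplication.Theorems.FarEdgeDescentSpecialClass

open Literature.Computability.AlgebraicComplexity
open Summit.MatrixMultiplication.MatrixMultiplication.Theorems.FarEdgeDescentSignTwist
open Summit.MatrixMultiplication.MatrixMultiplication.Theorems.FarEdgeDescentSignTwistDet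
open Summit.MatrixMultiplication.MatrixMultiplication.Theorems.FarEdgeDescentSignTwistComm
open Summit.MatrixMultiplication.MatrixMultiplication.Theorems.FarEdgeDescentSignTwistCommPow
open Summit.MatrixMultiplication.MatrixMultiplication.Theorems.FarEdgeDescentWeightFamily
open Summit.MatrixMultiplication.MatrixMultiplication.Theorems.FarEdgeDescentGenericDomination
open Summit.MatrixMultiplication.MatrixMultiplication.Theorems.FarEdgeDescentRankOneCoupling
open Summit.MatrixMultiplication.MatrixMultiplication.Theorems.FarEdgeDescentSpectralSublevel
open Summit.MatrixMultiplication.MatrixMultiplication.Theorems.FarEdgeDescentSupportClass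

/-! ## §1 The deleted entry `p₀` and the elementary tensor `E = 𝔖(1) − 𝔖(0)` -/

section AnyField

variable {K : Type} [Field K]

/-- The statement "`(a, x, c)` is the deleted entry `p₀ = (inr (1,0), (1,0), inr (0,0))`".
[cite: BlaserChristandlZuiddam2017, Def. 5] -/
abbrev IsP0 (a : Leaf2) (x : Fin 2 × Fin 2) (c : Leaf2) : Prop :=
  a = Sum.inr (1, 0) ∧ x = (1, 0) ∧ c = Sum.inr (0, 0)

/-- The elementary tensor at the deleted entry. [cite: BlaserChristandlZuiddam2017, Def. 5] -/
def E1 (K : Type) [Field K] : Leaf2 → (Fin 2 × Fin 2) → Leaf2 → K := fun a x c =>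
  if IsP0 a x c then 1 else 0

/-- `𝔖(1) − 𝔖(0) = E`. [cite: BlaserChristandlZuiddam2017, Def. 5] -/
theorem fam_one_sub_fam_zero_eq_E1 : fam K 1 - fam K 0 = E1 K := by
  rw [fam_one_sub_fam_zero K]
  funext a x c
  simp only [triad_apply, E1, IsP0]
  by_cases ha : a = Sum.inr (1, 0) <;> by_cases hx : x = (1, 0) <;>
    by_cases hc : c = Sum.inr (0, 0) <;> simp [ha, hx, hc]

/-- Every member is `𝔖(0) + q • E`. [cite: BlaserChristandlZuiddam2017, Def. 5] -/
theorem fam_eq_fam_zero_add (q : K) : fam K q = fam K 0 + q • E1 K := by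
  rw [← fam_one_sub_fam_zero_eq_E1, fam_eq_add_smul q 0, sub_zero]

/-- `𝔖(0)` vanishes at the deleted entry. [cite: BlaserChristandlZuiddam2017, Def. 5] -/
theorem fam_zero_p₀ : fam K 0 (Sum.inr (1, 0)) (1, 0) (Sum.inr (0, 0)) = 0 := by
  rw [fam_inr_diag]
  simp [famW]

/-- `𝔖(1)` is `1` at the deleted entry. [cite: BlaserChristandlZuiddam2017, Def. 5] -/
theorem fam_one_p₀ : fam K 1 (Sum.inr (1, 0)) (1, 0) (Sum.inr (0, 0)) = 1 := by
  rw [fam_inr_diag]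
  simp [famW]

/-- Off the deleted entry every member agrees with `𝔖(0)`.
[cite: BlaserChristandlZuiddam2017, Def. 5] -/
theorem fam_apply_of_not_isP0 (q : K) {a : Leaf2} {x : Fin 2 × Fin 2} {c : Leaf2}
    (h : ¬ IsP0 a x c) : fam K q a x c = fam K 0 a x c := by
  have e := congrFun (congrFun (congrFun (fam_eq_fam_zero_add q) a) x) c
  rw [e, Pi.add_apply, Pi.add_apply, Pi.add_apply, Pi.smul_apply, Pi.smul_apply, Pi.smul_apply,
    E1, if_neg h, smul_zero, add_zero]

/-- `supp 𝔖(0) = supp 𝔖(1) ∖ {p₀}`: where `𝔖(0)` vanishes, either `𝔖(1)` vanishes or we are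
at the deleted entry. [cite: BlaserChristandlZuiddam2017, Def. 5] -/
theorem fam_one_eq_zero_or_isP0 {a : Leaf2} {x : Fin 2 × Fin 2} {c : Leaf2}
    (h : fam K 0 a x c = 0) : fam K 1 a x c = 0 ∨ IsP0 a x c := by
  by_cases hp : IsP0 a x c
  · exact Or.inr hp
  · exact Or.inl (by rw [fam_apply_of_not_isP0 1 hp, h])

/-! ## §2 Normal form at the deleted entry: full support on `supp 𝔖(0)` is torus · `𝔖(0)` -/

/-- **Normal form of the `p₀`-special stratum**: a tensor supported inside `supp 𝔖(1)`,
vanishing at the deleted entry and non-zero on the rest of `supp 𝔖(0)`, is a nowhere-zero torus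
translate of `𝔖(0)` — apply BCZ's Lemma 3 to `T + E` and delete the entry again.
[cite: BlaserChristandlZuiddam2017, Lemma 3] -/
theorem exists_scale_fam_zero {T : Leaf2 → (Fin 2 × Fin 2) → Leaf2 → K}
    (hT : ∀ a x c, fam K 1 a x c = 0 → T a x c = 0)
    (h0 : T (Sum.inr (1, 0)) (1, 0) (Sum.inr (0, 0)) = 0)
    (hfull : ∀ a x c, fam K 0 a x c ≠ 0 → T a x c ≠ 0) :
    ∃ (α : Leaf2 → K) (β : Fin 2 × Fin 2 → K) (γ : Leaf2 → K),
      (∀ a, α a ≠ 0) ∧ (∀ b, β b ≠ 0) ∧ (∀ c, γ c ≠ 0) ∧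
        T = fun a b c => α a * β b * γ c * fam K 0 a b c := by
  have hS : SameSupport (T + E1 K) (fam K 1) := by
    intro a x c
    show T a x c + E1 K a x c ≠ 0 ↔ fam K 1 a x c ≠ 0
    by_cases hp : IsP0 a x c
    · obtain ⟨rfl, rfl, rfl⟩ := hp
      rw [h0, fam_one_p₀, E1, if_pos ⟨rfl, rfl, rfl⟩]
      simp
    · rw [E1, if_neg hp, add_zero, fam_apply_of_not_isP0 1 hp]
      exact ⟨fun hne h0' => hne (hT a x c (by rw [fam_apply_of_not_isP0 1 hp]; exact h0')),
        fun hne => hfull a x c hne⟩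
  obtain ⟨α, β, γ, q, hα, hβ, hγ, -, hEq⟩ := exists_scale_fam_of_sameSupport hS
  refine ⟨α, β, γ, hα, hβ, hγ, funext fun a => funext fun x => funext fun c => ?_⟩
  have e := congrFun (congrFun (congrFun hEq a) x) c
  simp only [Pi.add_apply] at e
  by_cases hp : IsP0 a x c
  · obtain ⟨rfl, rfl, rfl⟩ := hp
    rw [h0, fam_zero_p₀, mul_zero]
  · rw [E1, if_neg hp, add_zero, fam_apply_of_not_isP0 q hp] at e
    exact e

/-! ## §3 Symmetries of the coherent member: three involutions, transitive on the support -/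

/-- Side swap `inl z ↔ inr z`. [folklore] -/
def sideSwap : Leaf2 ≃ Leaf2 where
  toFun := Sum.swap
  invFun := Sum.swap
  left_inv := fun a => Sum.swap_swap a
  right_inv := fun a => Sum.swap_swap a

/-- Row flip `(i, 0) ↦ (1 − i, 0)` on both sides. [folklore] -/
def rowFlip : Leaf2 ≃ Leaf2 where
  toFun := Sum.map (fun z => (1 - z.1, z.2)) (fun z => (1 - z.1, z.2))
  invFun := Sum.map (fun z => (1 - z.1, z.2)) (fun z => (1 - z.1, z.2))
  left_inv := by decide
  right_inv := by decide

/-- Flip of the first middle coordinate `(x₁, x₂) ↦ (1 − x₁, x₂)`. [folklore] -/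
def xFlip₁ : (Fin 2 × Fin 2) ≃ (Fin 2 × Fin 2) where
  toFun x := (1 - x.1, x.2)
  invFun x := (1 - x.1, x.2)
  left_inv := by decide
  right_inv := by decide

/-- Flip of the second middle coordinate `(x₁, x₂) ↦ (x₁, 1 − x₂)`. [folklore] -/
def xFlip₂ : (Fin 2 × Fin 2) ≃ (Fin 2 × Fin 2) where
  toFun x := (x.1, 1 - x.2)
  invFun x := (x.1, 1 - x.2)
  left_inv := by decide
  right_inv := by decide

/-- The support condition is invariant under the side swap (kernel check). [folklore] -/
theorem cond_sideSwap : ∀ (a : Leaf2) (x : Fin 2 × Fin 2) (c : Leaf2),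
    (side (sideSwap a) = side (sideSwap c) ∧
        (Equiv.refl _) x = (row (sideSwap a), row (sideSwap c))) ↔
      (side a = side c ∧ x = (row a, row c)) := by
  decide

/-- … under the row flip of the first leaf together with `xFlip₁` (kernel check). [folklore] -/
theorem cond_flipRow : ∀ (a : Leaf2) (x : Fin 2 × Fin 2) (c : Leaf2),
    (side (rowFlip a) = side ((Equiv.refl _) c) ∧
        xFlip₁ x = (row (rowFlip a), row ((Equiv.refl _) c))) ↔
      (side a = side c ∧ x = (row a, row c)) := by
  decide

/-- … under the row flip of the second leaf together with `xFlip₂` (kernel check). [folklore] -/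
theorem cond_flipCol : ∀ (a : Leaf2) (x : Fin 2 × Fin 2) (c : Leaf2),
    (side ((Equiv.refl _) a) = side (rowFlip c) ∧
        xFlip₂ x = (row ((Equiv.refl _) a), row (rowFlip c))) ↔
      (side a = side c ∧ x = (row a, row c)) := by
  decide

/-- **`𝔖(1)` is fixed by the side swap.** [cite: BlaserChristandlZuiddam2017, §2] -/
theorem fam_one_sideSwap :
    (fun a x c => fam K 1 (sideSwap a) ((Equiv.refl _) x) (sideSwap c)) = fam K 1 := by
  funext a x c
  rw [fam_apply, fam_apply, wS_one, wS_one]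
  exact if_congr (cond_sideSwap a x c) rfl rfl

/-- **`𝔖(1)` is fixed by the row flip of the first leaf.**
[cite: BlaserChristandlZuiddam2017, §2] -/
theorem fam_one_flipRow :
    (fun a x c => fam K 1 (rowFlip a) (xFlip₁ x) ((Equiv.refl _) c)) = fam K 1 := by
  funext a x c
  rw [fam_apply, fam_apply, wS_one, wS_one]
  exact if_congr (cond_flipRow a x c) rfl rfl

/-- **`𝔖(1)` is fixed by the row flip of the second leaf.**
[cite: BlaserChristandlZuiddam2017, §2] -/
theorem fam_one_flipCol :
    (fun a x c => fam K 1 ((Equiv.refl _) a) (xFlip₂ x) (rowFlip c)) = fam K 1 := by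
  funext a x c
  rw [fam_apply, fam_apply, wS_one, wS_one]
  exact if_congr (cond_flipCol a x c) rfl rfl

/-- The support entry with side `σ` and rows `i, k`: `(leaf σ i, (i,k), leaf σ k)`. [folklore] -/
def pt (σ i k : Fin 2) : Leaf2 × (Fin 2 × Fin 2) × Leaf2 := (mkLeaf σ i, (i, k), mkLeaf σ k)

/-- **The support of `𝔖(1)` is the eight entries `pt σ i k`** (kernel check of the
combinatorics). [cite: BlaserChristandlZuiddam2017, §2] -/
theorem exists_pt_of_cond : ∀ (a : Leaf2) (x : Fin 2 × Fin 2) (c : Leaf2),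
    side a = side c ∧ x = (row a, row c) → ∃ σ i k, (a, x, c) = pt σ i k := by
  decide

/-- `𝔖(1)` is non-zero exactly on the support condition.
[cite: BlaserChristandlZuiddam2017, §2] -/
theorem fam_one_ne_zero_iff (a : Leaf2) (x : Fin 2 × Fin 2) (c : Leaf2) :
    fam K 1 a x c ≠ 0 ↔ side a = side c ∧ x = (row a, row c) := by
  rw [fam_apply, wS_one]
  simp

/-- The side swap moves `pt 1 i k` to `pt 0 i k`. [folklore] -/
theorem sideSwap_pt : ∀ i k : Fin 2,
    (sideSwap (pt 1 i k).1, (Equiv.refl _) (pt 1 i k).2.1, sideSwap (pt 1 i k).2.2) = pt 0 i k := by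
  decide

/-- The first row flip moves `pt σ 1 k` to `pt σ 0 k`. [folklore] -/
theorem flipRow_pt : ∀ σ k : Fin 2,
    (rowFlip (pt σ 1 k).1, xFlip₁ (pt σ 1 k).2.1, (Equiv.refl _) (pt σ 1 k).2.2) =
      pt σ 0 k := by
  decide

/-- The second row flip moves `pt σ i 0` to `pt σ i 1`. [folklore] -/
theorem flipCol_pt : ∀ σ i : Fin 2,
    ((Equiv.refl _) (pt σ i 0).1, xFlip₂ (pt σ i 0).2.1, rowFlip (pt σ i 0).2.2) =
      pt σ i 1 := by
  decide

/-- `pt 1 1 0` is the deleted entry. [folklore] -/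
theorem pt_one_one_zero : pt 1 1 0 = (Sum.inr (1, 0), (1, 0), Sum.inr (0, 0)) := by
  decide

/-! ## §4 Transport of caps along symmetries -/

/-- Universal spectral values are invariant under index relabelling. [cite: Strassen1988, §2] -/
theorem spectralPoint_reindex {Φ : SpectralMap K} (hΦ : IsUniversalSpectralPoint K Φ)
    (T : Leaf2 → (Fin 2 × Fin 2) → Leaf2 → K) (e₁ : Leaf2 ≃ Leaf2)
    (e₂ : (Fin 2 × Fin 2) ≃ (Fin 2 × Fin 2)) (e₃ : Leaf2 ≃ Leaf2) :
    Φ (fun a b c => T (e₁ a) (e₂ b) (e₃ c)) = Φ T :=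
  le_antisymm (hΦ.mono _ _ (tensorRestrictsTo_precomp T e₁ e₂ e₃))
    (hΦ.mono _ _ (tensorRestrictsTo_of_reindex T e₁ e₂ e₃))

/-- "Every member of the support class vanishing at the entry `p` has `Φ ≤ s`." [folklore] -/
def CapAt (Φ : SpectralMap K) (s : ℝ) (p : Leaf2 × (Fin 2 × Fin 2) × Leaf2) : Prop :=
  ∀ T : Leaf2 → (Fin 2 × Fin 2) → Leaf2 → K,
    (∀ a x c, fam K 1 a x c = 0 → T a x c = 0) → T p.1 p.2.1 p.2.2 = 0 → Φ T ≤ s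

/-- **Transport**: a symmetry of `𝔖(1)` carries the cap at `p` to the cap at its image of `p`.
[cite: Strassen1988, §2] -/
theorem capAt_transport {Φ : SpectralMap K} (hΦ : IsUniversalSpectralPoint K Φ) {s : ℝ}
    {e₁ e₃ : Leaf2 ≃ Leaf2} {e₂ : (Fin 2 × Fin 2) ≃ (Fin 2 × Fin 2)}
    (he : (fun a x c => fam K 1 (e₁ a) (e₂ x) (e₃ c)) = fam K 1)
    {p : Leaf2 × (Fin 2 × Fin 2) × Leaf2} (H : CapAt Φ s p) :
    CapAt Φ s (e₁ p.1, e₂ p.2.1, e₃ p.2.2) := by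
  intro T hT h0
  have hT' : ∀ a x c, fam K 1 a x c = 0 → T (e₁ a) (e₂ x) (e₃ c) = 0 := fun a x c h => by
    refine hT _ _ _ ?_
    have e : fam K 1 (e₁ a) (e₂ x) (e₃ c) = fam K 1 a x c :=
      congrFun (congrFun (congrFun he a) x) c
    rw [e]
    exact h
  have h := H (fun a x c => T (e₁ a) (e₂ x) (e₃ c)) hT' h0
  rwa [spectralPoint_reindex hΦ T e₁ e₂ e₃] at h

/-- Transport across the side swap: cap at `pt 1 i k` ⇒ cap at `pt 0 i k`. [folklore] -/
theorem capAt_side {Φ : SpectralMap K} (hΦ : IsUniversalSpectralPoint K Φ) {s : ℝ}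
    {i k : Fin 2} (H : CapAt Φ s (pt 1 i k)) : CapAt Φ s (pt 0 i k) := by
  have h := capAt_transport hΦ (fam_one_sideSwap (K := K)) H
  rwa [sideSwap_pt] at h

/-- Transport across the first row flip: cap at `pt σ 1 k` ⇒ cap at `pt σ 0 k`. [folklore] -/
theorem capAt_row {Φ : SpectralMap K} (hΦ : IsUniversalSpectralPoint K Φ) {s : ℝ}
    {σ k : Fin 2} (H : CapAt Φ s (pt σ 1 k)) : CapAt Φ s (pt σ 0 k) := by
  have h := capAt_transport hΦ (fam_one_flipRow (K := K)) H
  rwa [flipRow_pt] at h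

/-- Transport across the second row flip: cap at `pt σ i 0` ⇒ cap at `pt σ i 1`. [folklore] -/
theorem capAt_col {Φ : SpectralMap K} (hΦ : IsUniversalSpectralPoint K Φ) {s : ℝ}
    {σ i : Fin 2} (H : CapAt Φ s (pt σ i 0)) : CapAt Φ s (pt σ i 1) := by
  have h := capAt_transport hΦ (fam_one_flipCol (K := K)) H
  rwa [flipCol_pt] at h

/-- **From the deleted entry to all eight**: a cap at `p₀ = pt 1 1 0` holds at every support
entry. [folklore] -/
theorem capAt_all {Φ : SpectralMap K} (hΦ : IsUniversalSpectralPoint K Φ) {s : ℝ}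
    (b : CapAt Φ s (pt 1 1 0)) : ∀ σ i k, CapAt Φ s (pt σ i k) := by
  intro σ i k
  fin_cases σ <;> fin_cases i <;> fin_cases k
  · exact capAt_side hΦ (capAt_row hΦ b)
  · exact capAt_side hΦ (capAt_row hΦ (capAt_col hΦ b))
  · exact capAt_side hΦ b
  · exact capAt_side hΦ (capAt_col hΦ b)
  · exact capAt_row hΦ b
  · exact capAt_row hΦ (capAt_col hΦ b)
  · exact b
  · exact capAt_col hΦ b

end AnyField

end Summit.MatrixMultiplication.MatrixMultiplication.Theorems.FarEdgeDescentSpecialClass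

end
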